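import Literature.Analysis.FluidPDE.HardSpherePhaseSpace

/-!
# `InfluenceLocality` (stmt-AtomisticToContinuum-13916) — exact collision algebra of the ignition cascade

Phase 2, step V1 (exact part) of the refutation line `ignition-cascade-refutation` (lead c1, 2026-08-16;
design document `Cruxes/InfluenceLocality/Lines/ignition-cascade-refutation.md` §2): the three elastic
equal-mass events the designed cascade is built from, as identities of the tree's reflection law
`reflectVel n (v, w) = (v − (⟪v − w, n⟫/‖n‖²) n, w + (⟪v − w, n⟫/‖n‖²) n)`:

* `reflectVel_collinear` / `reflectVel_headOn_rest` — HEAD-ON RELAY: collinear velocities are exchanged;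
  a striker `u • d` meeting a resting sphere centred on its line stops dead and hands over `u • d`;
* `reflectVel_typeA` — SPLIT: striker `u • e`, contact normal `e + f` (`e ⊥ f` unit): the target leaves
  with `(u/2)(e + f)`, the striker keeps `(u/2)(e − f)` (two face-diagonal movers of equal energy);
* `reflectVel_typeB` — RE-AXIS: diagonal mover `v • (e + f)`, contact normal `e`: the target leaves
  with `v • e`, the mover keeps `v • f`;
* the contact instants: in all three geometries the contact happens exactly when the mover's centre
  reaches the lattice point (`typeA_contact_iff`, `typeB_contact_iff`), which is what makes the designed
  positions `lattice + {(σ/√2)(±eᵢ ± eⱼ), ±σ eᵢ}` close up exactly along an arbitrarily deep cascade.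

Pure inner-product-space algebra; nothing here asserts a Theses decl.
-/

namespace Summit.AtomisticToContinuum.HydrodynamicLimit.Theorems.InfluenceLocality.Negative

open Literature.Analysis.FluidPDE
open scoped InnerProductSpace RealInnerProductSpace

noncomputable section

variable {E : Type*} [NormedAddCommGroup E] [InnerProductSpace ℝ E]

/-- HEAD-ON (collinear) elastic collision of equal masses: the velocities are exchanged. -/
theorem reflectVel_collinear {d : E} (hd : d ≠ 0) (a b : ℝ) :
    reflectVel d (a • d, b • d) = (b • d, a • d) := by
  have hn : ‖d‖ ^ 2 ≠ 0 := pow_ne_zero 2 (norm_ne_zero_iff.2 hd)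
  have hc : ⟪a • d - b • d, d⟫ / ‖d‖ ^ 2 = a - b := by
    rw [← sub_smul, inner_smul_left, real_inner_self_eq_norm_sq]
    field_simp
    simp
  simp only [reflectVel, hc]
  refine Prod.ext ?_ ?_
  · show a • d - (a - b) • d = b • d
    rw [sub_smul]; abel
  · show b • d + (a - b) • d = a • d
    rw [sub_smul]; abel

/-- HEAD-ON RELAY onto a resting sphere: the striker stops dead, the target takes its velocity. -/
theorem reflectVel_headOn_rest {d : E} (hd : d ≠ 0) (u : ℝ) :
    reflectVel d (u • d, 0) = (0, u • d) := by
  simpa using reflectVel_collinear hd u 0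

/-- TYPE A (split): striker `u • e` on a resting target with contact normal `e + f`, `e, f` orthonormal:
target `→ (u/2)(e+f)`, striker `→ (u/2)(e−f)`. -/
theorem reflectVel_typeA {e f : E} (he : ‖e‖ = 1) (hf : ‖f‖ = 1) (hef : ⟪e, f⟫ = 0) (u : ℝ) :
    reflectVel (e + f) (u • e, 0) = ((u / 2) • (e - f), (u / 2) • (e + f)) := by
  have hee : ⟪e, e⟫ = 1 := by rw [real_inner_self_eq_norm_sq, he, one_pow]
  have hff : ⟪f, f⟫ = 1 := by rw [real_inner_self_eq_norm_sq, hf, one_pow]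
  have hfe : ⟪f, e⟫ = 0 := by rw [real_inner_comm]; exact hef
  have hn : ‖e + f‖ ^ 2 = 2 := by
    rw [← real_inner_self_eq_norm_sq, inner_add_left, inner_add_right, inner_add_right, hee, hef, hfe, hff]
    norm_num
  have hc : ⟪u • e - 0, e + f⟫ / ‖e + f‖ ^ 2 = u / 2 := by
    rw [sub_zero, inner_smul_left, inner_add_right, hee, hef, hn]
    simp
  simp only [reflectVel, hc, zero_add]
  refine Prod.ext ?_ rfl
  simp only
  rw [smul_sub, smul_add]
  have : u • e = (u / 2) • e + (u / 2) • e := by rw [← add_smul]; ring_nf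
  rw [this]
  abel

/-- TYPE B (re-axis): diagonal mover `v • (e + f)` on a resting target with contact normal `e`
(`‖e‖ = 1`, `e ⊥ f`): target `→ v • e`, mover `→ v • f`. -/
theorem reflectVel_typeB {e f : E} (he : ‖e‖ = 1) (hef : ⟪e, f⟫ = 0) (v : ℝ) :
    reflectVel e (v • (e + f), 0) = (v • f, v • e) := by
  have hee : ⟪e, e⟫ = 1 := by rw [real_inner_self_eq_norm_sq, he, one_pow]
  have hfe : ⟪f, e⟫ = 0 := by rw [real_inner_comm]; exact hef
  have hc : ⟪v • (e + f) - 0, e⟫ / ‖e‖ ^ 2 = v := by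
    rw [sub_zero, inner_smul_left, inner_add_left, hee, hfe, he]
    simp
  simp only [reflectVel, hc, zero_add]
  refine Prod.ext ?_ rfl
  simp only
  rw [smul_add]
  abel

/-! ## Contact instants: the mover's centre is at the lattice point -/

/-- TYPE A contact geometry: a centre moving along `X + s • e` is at distance `σ` from the displaced
target centre `X + (σ/√2)(e + f)` iff `s = 0` or `s = √2 σ`; in particular the FIRST contact along the
approach (`s ≤ 0` before, increasing) is at `s = 0`, i.e. exactly at the lattice point `X`. -/
theorem typeA_contact_iff {e f : E} (he : ‖e‖ = 1) (hf : ‖f‖ = 1) (hef : ⟪e, f⟫ = 0)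
    {σ : ℝ} (hσ : 0 < σ) (s : ℝ) :
    ‖s • e - (σ / Real.sqrt 2) • (e + f)‖ ^ 2 = σ ^ 2 ↔ s = 0 ∨ s = Real.sqrt 2 * σ := by
  have hee : ⟪e, e⟫ = 1 := by rw [real_inner_self_eq_norm_sq, he, one_pow]
  have hff : ⟪f, f⟫ = 1 := by rw [real_inner_self_eq_norm_sq, hf, one_pow]
  have hfe : ⟪f, e⟫ = 0 := by rw [real_inner_comm]; exact hef
  have h2 : Real.sqrt 2 ^ 2 = 2 := Real.sq_sqrt (by norm_num)
  have hs2 : 0 < Real.sqrt 2 := Real.sqrt_pos.2 (by norm_num)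
  -- expand the square
  have hexp : ‖s • e - (σ / Real.sqrt 2) • (e + f)‖ ^ 2 =
      (s - σ / Real.sqrt 2) ^ 2 + (σ / Real.sqrt 2) ^ 2 := by
    have : s • e - (σ / Real.sqrt 2) • (e + f) = (s - σ / Real.sqrt 2) • e - (σ / Real.sqrt 2) • f := by
      rw [smul_add, sub_smul]; abel
    rw [this, ← real_inner_self_eq_norm_sq, inner_sub_left, inner_sub_right, inner_sub_right,
      inner_smul_left, inner_smul_right, inner_smul_left, inner_smul_right, inner_smul_left,
      inner_smul_right, inner_smul_left, inner_smul_right, hee, hef, hfe, hff]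
    simp only [RCLike.conj_to_real]
    ring
  rw [hexp]
  have hσ2 : (σ / Real.sqrt 2) ^ 2 = σ ^ 2 / 2 := by rw [div_pow, h2]
  rw [hσ2]
  constructor
  · intro h
    have h' : (s - σ / Real.sqrt 2) ^ 2 = (σ / Real.sqrt 2) ^ 2 := by rw [hσ2]; linarith
    have hprod : s * (s - 2 * (σ / Real.sqrt 2)) = 0 := by nlinarith
    rcases mul_eq_zero.1 hprod with h1 | h1
    · left; exact h1
    · right
      have hs : s = 2 * (σ / Real.sqrt 2) := by linarith
      rw [hs]
      field_simp
      nlinarith [h2]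
  · rintro (rfl | rfl)
    · rw [zero_sub, neg_sq, hσ2]; ring
    · have : Real.sqrt 2 * σ - σ / Real.sqrt 2 = σ / Real.sqrt 2 := by
        field_simp; nlinarith [h2]
      rw [this, hσ2]; ring

/-- TYPE B contact geometry: a centre moving along the diagonal `Y + s • (e + f)` is at distance `σ` from
the displaced target centre `Y + σ • e` iff `s = 0` or `s = σ`: the first contact is at the lattice
point `Y` (`s = 0`). -/
theorem typeB_contact_iff {e f : E} (he : ‖e‖ = 1) (hf : ‖f‖ = 1) (hef : ⟪e, f⟫ = 0) (σ s : ℝ) :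
    ‖s • (e + f) - σ • e‖ ^ 2 = σ ^ 2 ↔ s = 0 ∨ s = σ := by
  have hee : ⟪e, e⟫ = 1 := by rw [real_inner_self_eq_norm_sq, he, one_pow]
  have hff : ⟪f, f⟫ = 1 := by rw [real_inner_self_eq_norm_sq, hf, one_pow]
  have hfe : ⟪f, e⟫ = 0 := by rw [real_inner_comm]; exact hef
  have hexp : ‖s • (e + f) - σ • e‖ ^ 2 = (s - σ) ^ 2 + s ^ 2 := by
    have : s • (e + f) - σ • e = (s - σ) • e + s • f := by rw [smul_add, sub_smul]; abel
    rw [this, ← real_inner_self_eq_norm_sq, inner_add_left, inner_add_right, inner_add_right,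
      inner_smul_left, inner_smul_right, inner_smul_left, inner_smul_right, inner_smul_left,
      inner_smul_right, inner_smul_left, inner_smul_right, hee, hef, hfe, hff]
    simp only [RCLike.conj_to_real]
    ring
  rw [hexp]
  constructor
  · intro h
    have h0 : s * (s - σ) = 0 := by nlinarith
    rcases mul_eq_zero.1 h0 with h1 | h1
    · left; exact h1
    · right; linarith
  · rintro (rfl | rfl) <;> ring

end

end Summit.AtomisticToContinuum.HydrodynamicLimit.Theorems.InfluenceLocality.Negative
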